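import Summits.AtomisticToContinuum.FouriersLaw.Theorems.BondHeatUncertaintyBoundedResponseBathHeatKickProfileA
import HarnessLib

/-!
# BondHeatUncertainty / BoundedResponse — «KickProfile» §2–§3: the KICK AVERAGE (Stein by resampling, evenness) and the three RESPONSE CURVES of the boundary
(decomp-a2c lens-1, g110, NODE 110 «KickProfile / EnergyResponse»; part 2 of 4 — overview, ladder and references in part 1 `…KickProfileA`)

§2 `kickAvg F k = ∫ F(q, p[0 ↦ k]) dμ_T`; ★ `integral_weight_mul_kickAvg`: `∫ h(p₀)·F dμ_T = ∫ h(k)·F̄(k) dν_T` for measurable `F, h` with `h(p₀)F ∈ L¹(μ_T)`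
(resampling invariance `lightCone_gibbs_map_momentum_resample` + Fubini; no derivative, no continuity); the thermal case, the profile mean, the Stein floor
`∫ (p₀² − T)F dμ_T ≥ −𝔇_T(F̄)` and its two sign suppliers (a.e.-monotone-in-energy / a.e.-convex profile); `kickAvg_neg`: flip-even `F` ⟹ even profile.
§3 the profiles `Ḡ_{N,t}` (`kinKickProfile`, energy forecast), `M̄_{N,t}` (`sqFcastKickProfile`, squared momentum forecast), `V̄_{N,t}` (`varKickProfile`, forecast
boundary temperature); ★★ `K_N(t) = ∫ θ_T Ḡ dν_T`, `CP_N(t) = ∫ θ_T M̄ dν_T`, `VC_N(t) = ∫ θ_T V̄ dν_T` (`bathKinCorr_eq_integral_kinKickProfile`, `…CommonPast…`,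
`…VarChannel…`); means `∫ Ḡ dν_T = T`, `∫ M̄ dν_T ≤ T`; `V̄, M̄ ≥ 0`; ★ all three curves are EVEN in `k` (`kickProfiles_neg`).  No `sorry`, no new axioms.
-/

noncomputable section

open MeasureTheory ProbabilityTheory Filter Topology Set Function
open scoped NNReal ENNReal
open Literature.MathematicalPhysics.KineticTheory.HeatConduction
open Literature.MathematicalPhysics.KineticTheory OscillatorChain
open Literature.Probability.Process
open Summit.AtomisticToContinuum.FouriersLaw.Theorems.IncoherentChannel.Negative.KernelMoments
  (harmonic_kernel_momentum harmonic_kernel_momentum_sq)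
open Summit.AtomisticToContinuum.FouriersLaw.Theorems.IncoherentChannel.Negative.HarmonicFlow
  (harmonic_chainFlow_zero_noise_linear integral_gibbsMeasure_comp_neg integral_gibbsMeasure_eq_zero_of_odd)
open Summit.AtomisticToContinuum.FouriersLaw.Theorems.IncoherentChannel.Negative.GibbsStein
  (integrable_gibbsMeasure_of_growth pow_le_one_add_sq_sq)

namespace Summit.AtomisticToContinuum.FouriersLaw.Theorems.BoundedResponse.HeatSpreading

/-! ## §2 The KICK AVERAGE `F̄(k) = ∫ F(q, p[0 ↦ k]) dμ_T`: Stein by resampling, evenness -/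

section Kick

variable {ω₂ lam β γ : ℝ} {T : ℝ}

/-- **KICK AVERAGE** of a functional `F` on the `n+1`-site phase space at boundary momentum `k`: the Gibbs average of `F` with `p₀` SET to `k`
(`F̄(k) := ∫ F(q, p[0 ↦ k]) dμ_T(q,p)`; `μ_T`-a.e. in `k` the section is integrable whenever `F ∈ L¹(μ_T)`). [formal bookkeeping] -/
def kickAvg (ω₂ lam β γ T : ℝ) (n : ℕ) (F : PhaseSpace (n + 1) → ℝ) (k : ℝ) : ℝ :=
  ∫ z, F (z.1, Function.update z.2 0 k) ∂((pinnedChain ω₂ lam β γ).gibbsMeasure (n + 1) T)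

/-- Measurability of `(k, z) ↦ (q, p[0 ↦ k])`. [folklore] -/
theorem measurable_setMomentum (n : ℕ) :
    Measurable fun x : ℝ × PhaseSpace (n + 1) => ((x.2.1, Function.update x.2.2 0 x.1) : PhaseSpace (n + 1)) :=
  (measurable_fst.comp measurable_snd).prodMk
    (measurable_update'.comp ((measurable_snd.comp measurable_snd).prodMk measurable_fst))

section Stein

variable (hω : 0 < ω₂) (hl : 0 ≤ lam) (hβ : 0 ≤ β) (hT : 0 < T)
include hω hl hβ hT

/-- ★★ **STEIN BY RESAMPLING** (no derivatives): for measurable `F`, `h` with `h(p₀)·F ∈ L¹(μ_T)`,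
`∫ h(p₀)·F dμ_T = ∫ h(k)·F̄(k) dν_T(k)` and `h·F̄ ∈ L¹(ν_T)` — because `p₀` is an independent `N(0,T)` coordinate of `μ_T`
(`lightCone_gibbs_map_momentum_resample`) and Fubini. [this cell; folklore mechanism] -/
theorem integral_weight_mul_kickAvg {n : ℕ} {F : PhaseSpace (n + 1) → ℝ} {h : ℝ → ℝ} (hF : Measurable F) (hh : Measurable h)
    (hI : Integrable (fun z : PhaseSpace (n + 1) => h (z.2 0) * F z) ((pinnedChain ω₂ lam β γ).gibbsMeasure (n + 1) T)) :
    Integrable (fun k : ℝ => h k * kickAvg ω₂ lam β γ T n F k) (gaussianReal 0 T.toNNReal) ∧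
      ∫ k, h k * kickAvg ω₂ lam β γ T n F k ∂(gaussianReal 0 T.toNNReal) =
        ∫ z, h (z.2 0) * F z ∂((pinnedChain ω₂ lam β γ).gibbsMeasure (n + 1) T) := by
  set μ := (pinnedChain ω₂ lam β γ).gibbsMeasure (n + 1) T with hμ
  set ν := gaussianReal 0 T.toNNReal with hν
  haveI : IsProbabilityMeasure μ := pinnedChain_isProbabilityMeasure_gibbsMeasure hω hl hβ γ (n + 1) hT
  set H : ℝ × PhaseSpace (n + 1) → ℝ := fun x => h x.1 * F (x.2.1, Function.update x.2.2 0 x.1) with hH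
  have hHm : Measurable H := (hh.comp measurable_fst).mul (hF.comp (measurable_setMomentum n))
  have hΦ := PhononMeanFreePath.lightCone_gibbs_map_momentum_resample (γ := γ) hω hl hβ hT (0 : Fin (n + 1)) (n := n)
  have hΦm : Measurable fun x : PhaseSpace (n + 1) × ℝ =>
      (x.1.2 0, ((x.1.1, Function.update x.1.2 0 x.2) : PhaseSpace (n + 1))) :=
    ((measurable_pi_apply 0).comp (measurable_snd.comp measurable_fst)).prodMk
      (PhononMeanFreePath.lightCone_measurable_resample 0)
  have hcomp : ∀ x : PhaseSpace (n + 1) × ℝ,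
      H (x.1.2 0, ((x.1.1, Function.update x.1.2 0 x.2) : PhaseSpace (n + 1))) = h (x.1.2 0) * F x.1 := by
    intro x
    simp only [hH, Function.update_idem, Function.update_eq_self, Prod.mk.eta]
  have hIH : Integrable H (ν.prod μ) := by
    rw [hν, hμ, ← hΦ, integrable_map_measure hHm.aestronglyMeasurable hΦm.aemeasurable]
    exact (hI.comp_fst (gaussianReal 0 T.toNNReal)).congr (ae_of_all _ fun x => (hcomp x).symm)
  have hsec : ∀ k : ℝ, ∫ w, H (k, w) ∂μ = h k * kickAvg ω₂ lam β γ T n F k := by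
    intro k
    simp only [hH, kickAvg]
    exact integral_const_mul (h k) _
  refine ⟨hIH.integral_prod_left.congr (ae_of_all _ fun k => hsec k), ?_⟩
  calc ∫ k, h k * kickAvg ω₂ lam β γ T n F k ∂ν
      = ∫ k, ∫ w, H (k, w) ∂μ ∂ν := integral_congr_ae (ae_of_all _ fun k => (hsec k).symm)
    _ = ∫ x, H x ∂(ν.prod μ) := (integral_prod H hIH).symm
    _ = ∫ x, h (x.1.2 0) * F x.1 ∂(μ.prod ν) := by
        rw [hν, hμ, ← hΦ, integral_map hΦm.aemeasurable hHm.aestronglyMeasurable]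
        exact integral_congr_ae (ae_of_all _ fun x => hcomp x)
    _ = ∫ z, h (z.2 0) * F z ∂μ := by
        have e := integral_fun_fst (μ := μ) (ν := ν) (fun z : PhaseSpace (n + 1) => h (z.2 0) * F z)
        simp only [probReal_univ, one_smul] at e
        exact e

/-- ★ The thermal case `h = θ_T`: `∫ (p₀² − T)·F dμ_T = ∫ (k² − T)·F̄(k) dν_T` and `θ_T·F̄ ∈ L¹(ν_T)`. [this cell] -/
theorem integral_kinObs_mul_eq_kickAvg {n : ℕ} {F : PhaseSpace (n + 1) → ℝ} (hF : Measurable F)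
    (hI : Integrable (fun z : PhaseSpace (n + 1) => (z.2 0 ^ 2 - T) * F z) ((pinnedChain ω₂ lam β γ).gibbsMeasure (n + 1) T)) :
    Integrable (fun k : ℝ => (k ^ 2 - T) * kickAvg ω₂ lam β γ T n F k) (gaussianReal 0 T.toNNReal) ∧
      ∫ k, (k ^ 2 - T) * kickAvg ω₂ lam β γ T n F k ∂(gaussianReal 0 T.toNNReal) =
        ∫ z, (z.2 0 ^ 2 - T) * F z ∂((pinnedChain ω₂ lam β γ).gibbsMeasure (n + 1) T) :=
  integral_weight_mul_kickAvg hω hl hβ hT hF (h := fun k => k ^ 2 - T) (by fun_prop) hI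

/-- The profile MEAN: `∫ F̄ dν_T = ∫ F dμ_T` and `F̄ ∈ L¹(ν_T)` for `F ∈ L¹(μ_T)`. [this cell] -/
theorem integral_kickAvg {n : ℕ} {F : PhaseSpace (n + 1) → ℝ} (hF : Measurable F)
    (hI : Integrable F ((pinnedChain ω₂ lam β γ).gibbsMeasure (n + 1) T)) :
    Integrable (kickAvg ω₂ lam β γ T n F) (gaussianReal 0 T.toNNReal) ∧
      ∫ k, kickAvg ω₂ lam β γ T n F k ∂(gaussianReal 0 T.toNNReal) = ∫ z, F z ∂((pinnedChain ω₂ lam β γ).gibbsMeasure (n + 1) T) := by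
  have h := integral_weight_mul_kickAvg hω hl hβ hT hF (h := fun _ => (1 : ℝ)) measurable_const
    (hI.congr (ae_of_all _ fun z => (one_mul (F z)).symm))
  simp only [one_mul] at h
  exact h

/-- ★ **STEIN FLOOR FOR FUNCTIONALS**: `∫ (p₀² − T)·F dμ_T ≥ −𝔇_T(F̄)` — the correlation of the initial boundary heat with ANY later functional is floored by
the crossing defect of its kick profile. [this cell] -/
theorem integral_kinObs_mul_ge_neg_thermalCrossDefect {n : ℕ} {F : PhaseSpace (n + 1) → ℝ} (hF : Measurable F)
    (hI : Integrable (fun z : PhaseSpace (n + 1) => (z.2 0 ^ 2 - T) * F z) ((pinnedChain ω₂ lam β γ).gibbsMeasure (n + 1) T)) :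
    -thermalCrossDefect T (kickAvg ω₂ lam β γ T n F) ≤
      ∫ z, (z.2 0 ^ 2 - T) * F z ∂((pinnedChain ω₂ lam β γ).gibbsMeasure (n + 1) T) := by
  obtain ⟨hint, heq⟩ := integral_kinObs_mul_eq_kickAvg hω hl hβ hT hF hI
  rw [← heq]
  exact integral_sqSub_mul_ge_neg_thermalCrossDefect hT.le hint

/-- ★ Sign version: a kick profile that is (`ν_T`-a.e. equal to a curve) NONDECREASING IN THE INJECTED ENERGY gives `∫ (p₀² − T)·F dμ_T ≥ 0`. [this cell] -/
theorem integral_kinObs_mul_nonneg_of_monotoneSq {n : ℕ} {F : PhaseSpace (n + 1) → ℝ} (hF : Measurable F)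
    (hI : Integrable (fun z : PhaseSpace (n + 1) => (z.2 0 ^ 2 - T) * F z) ((pinnedChain ω₂ lam β γ).gibbsMeasure (n + 1) T))
    {R : ℝ → ℝ} (hmono : ∀ k₁ k₂ : ℝ, k₁ ^ 2 ≤ k₂ ^ 2 → R k₁ ≤ R k₂)
    (hae : kickAvg ω₂ lam β γ T n F =ᵐ[gaussianReal 0 T.toNNReal] R) :
    0 ≤ ∫ z, (z.2 0 ^ 2 - T) * F z ∂((pinnedChain ω₂ lam β γ).gibbsMeasure (n + 1) T) := by
  obtain ⟨hint, heq⟩ := integral_kinObs_mul_eq_kickAvg hω hl hβ hT hF hI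
  have hR : Integrable (fun k : ℝ => (k ^ 2 - T) * R k) (gaussianReal 0 T.toNNReal) :=
    hint.congr (by filter_upwards [hae] with k hk; rw [hk])
  rw [← heq, integral_congr_ae (show (fun k : ℝ => (k ^ 2 - T) * kickAvg ω₂ lam β γ T n F k) =ᵐ[gaussianReal 0 T.toNNReal]
    (fun k => (k ^ 2 - T) * R k) by filter_upwards [hae] with k hk; rw [hk])]
  exact integral_sqSub_mul_nonneg_of_affineCross hT.le hR (affineCross_of_monotoneSq hT.le hmono)

/-- ★ Sign version: a (`ν_T`-a.e.) CONVEX kick profile gives `∫ (p₀² − T)·F dμ_T ≥ 0` — KICK-CONVEXITY, the regularity-free `T²E[∂²_{p₀}F] ≥ 0`. [this cell] -/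
theorem integral_kinObs_mul_nonneg_of_convexOn {n : ℕ} {F : PhaseSpace (n + 1) → ℝ} (hF : Measurable F)
    (hI : Integrable (fun z : PhaseSpace (n + 1) => (z.2 0 ^ 2 - T) * F z) ((pinnedChain ω₂ lam β γ).gibbsMeasure (n + 1) T))
    {R : ℝ → ℝ} (hconv : ConvexOn ℝ Set.univ R) (hae : kickAvg ω₂ lam β γ T n F =ᵐ[gaussianReal 0 T.toNNReal] R) :
    0 ≤ ∫ z, (z.2 0 ^ 2 - T) * F z ∂((pinnedChain ω₂ lam β γ).gibbsMeasure (n + 1) T) := by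
  obtain ⟨hint, heq⟩ := integral_kinObs_mul_eq_kickAvg hω hl hβ hT hF hI
  have hR : Integrable (fun k : ℝ => (k ^ 2 - T) * R k) (gaussianReal 0 T.toNNReal) :=
    hint.congr (by filter_upwards [hae] with k hk; rw [hk])
  rw [← heq, integral_congr_ae (show (fun k : ℝ => (k ^ 2 - T) * kickAvg ω₂ lam β γ T n F k) =ᵐ[gaussianReal 0 T.toNNReal]
    (fun k => (k ^ 2 - T) * R k) by filter_upwards [hae] with k hk; rw [hk])]
  exact integral_sqSub_mul_nonneg_of_affineCross hT.le hR (affineCross_of_convexOn hT hconv)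

end Stein

/-- `p[0 ↦ k]` under the global flip: `(−p)[0 ↦ k] = −(p[0 ↦ −k])`. [folklore] -/
theorem update_zero_neg {n : ℕ} (p : Fin (n + 1) → ℝ) (k : ℝ) :
    Function.update (-p) 0 k = -Function.update p 0 (-k) := by
  funext j
  by_cases hj : j = 0
  · subst hj; simp
  · simp [Function.update_of_ne hj]

/-- ★ **EVENNESS**: the kick profile of a flip-EVEN functional is EVEN in `k` — it depends on the injected ENERGY `k²/2` only (the global flip `Π z = −z`
preserves every `μ_T`: `integral_gibbsMeasure_comp_neg`; no hypothesis on the parameters). [this cell] -/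
theorem kickAvg_neg {n : ℕ} {F : PhaseSpace (n + 1) → ℝ} (hF : ∀ z, F (-z) = F z) (k : ℝ) :
    kickAvg ω₂ lam β γ T n F (-k) = kickAvg ω₂ lam β γ T n F k := by
  unfold kickAvg
  have h := integral_gibbsMeasure_comp_neg (ω₂ := ω₂) (lam := lam) (β := β) (γ := γ) (n + 1) T
    (fun y : PhaseSpace (n + 1) => F (y.1, Function.update y.2 0 k))
  rw [h]
  refine integral_congr_ae (ae_of_all _ fun z => ?_)
  have e : ((z.1, Function.update z.2 0 (-k)) : PhaseSpace (n + 1)) = -(((-z).1, Function.update (-z).2 0 k) : PhaseSpace (n + 1)) := by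
    rw [Prod.fst_neg, Prod.snd_neg, update_zero_neg, Prod.neg_mk, neg_neg, neg_neg]
  show F (z.1, Function.update z.2 0 (-k)) = F ((-z).1, Function.update (-z).2 0 k)
  rw [e, hF]

end Kick

/-! ## §3 The three RESPONSE CURVES of the boundary: `Ḡ_{N,t}`, `M̄_{N,t}`, `V̄_{N,t}`; the kernel and its channels as 1-D thermal integrals -/

section Profiles

variable {ω₂ lam β γ : ℝ} {T : ℝ}

/-- **ENERGY RESPONSE CURVE `Ḡ_{N,t}(k) := ∫ G_t(q, p[0 ↦ k]) dμ_T`**, `G_t = P_t p₀²`: the mean boundary kinetic energy (×2) at time `t` after the bath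
particle's momentum has been SET to `k` in an equilibrium configuration — rest of the chain thermal, noise averaged (`N ≥ 1`; `0` for `N = 0`).
Census name: the KICK-108/110 profile `ĝ_t(k)`. [formal bookkeeping] -/
def kinKickProfile (ω₂ lam β γ T : ℝ) (N : ℕ) (t k : ℝ) : ℝ :=
  if h : 0 < N then
    ∫ z, (∫ y, (y.2 ⟨0, h⟩) ^ 2 ∂((pinnedChain ω₂ lam β γ).transitionKernel N T T t.toNNReal
        ((z.1, Function.update z.2 ⟨0, h⟩ k) : PhaseSpace N)))
      ∂((pinnedChain ω₂ lam β γ).gibbsMeasure N T)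
  else 0

/-- **COHERENT RESPONSE CURVE `M̄_{N,t}(k) := ∫ m_t(q, p[0 ↦ k])² dμ_T`**, `m_t = P_t p₀` the boundary momentum forecast (`N ≥ 1`; `0` for `N = 0`).
[formal bookkeeping] -/
def sqFcastKickProfile (ω₂ lam β γ T : ℝ) (N : ℕ) (t k : ℝ) : ℝ :=
  if h : 0 < N then
    ∫ z, (∫ y, y.2 ⟨0, h⟩ ∂((pinnedChain ω₂ lam β γ).transitionKernel N T T t.toNNReal
        ((z.1, Function.update z.2 ⟨0, h⟩ k) : PhaseSpace N))) ^ 2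
      ∂((pinnedChain ω₂ lam β γ).gibbsMeasure N T)
  else 0

/-- **TEMPERATURE RESPONSE CURVE `V̄_{N,t}(k) := ∫ V_t(q, p[0 ↦ k]) dμ_T`**, `V_t = G_t − m_t² = Var_z p₀(t)` the forecast kinetic TEMPERATURE of the
boundary (`N ≥ 1`; `0` for `N = 0`): the mean boundary temperature at time `t` after a kick of momentum `k`. [formal bookkeeping] -/
def varKickProfile (ω₂ lam β γ T : ℝ) (N : ℕ) (t k : ℝ) : ℝ :=
  if h : 0 < N then
    ∫ z, ((∫ y, (y.2 ⟨0, h⟩) ^ 2 ∂((pinnedChain ω₂ lam β γ).transitionKernel N T T t.toNNReal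
          ((z.1, Function.update z.2 ⟨0, h⟩ k) : PhaseSpace N))) -
        (∫ y, y.2 ⟨0, h⟩ ∂((pinnedChain ω₂ lam β γ).transitionKernel N T T t.toNNReal
          ((z.1, Function.update z.2 ⟨0, h⟩ k) : PhaseSpace N))) ^ 2)
      ∂((pinnedChain ω₂ lam β γ).gibbsMeasure N T)
  else 0

/-- `Ḡ_{n+1,t}` is the kick average of `G_t`. [formal bookkeeping] -/
theorem kinKickProfile_succ (ω₂ lam β γ T : ℝ) (n : ℕ) (t : ℝ) :
    kinKickProfile ω₂ lam β γ T (n + 1) t = kickAvg ω₂ lam β γ T n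
      (fun z => ∫ y, y.2 0 ^ 2 ∂((pinnedChain ω₂ lam β γ).transitionKernel (n + 1) T T t.toNNReal z)) := by
  funext k
  unfold kinKickProfile kickAvg
  rw [dif_pos (Nat.succ_pos n)]
  rfl

/-- `M̄_{n+1,t}` is the kick average of `m_t²`. [formal bookkeeping] -/
theorem sqFcastKickProfile_succ (ω₂ lam β γ T : ℝ) (n : ℕ) (t : ℝ) :
    sqFcastKickProfile ω₂ lam β γ T (n + 1) t = kickAvg ω₂ lam β γ T n
      (fun z => (∫ y, y.2 0 ∂((pinnedChain ω₂ lam β γ).transitionKernel (n + 1) T T t.toNNReal z)) ^ 2) := by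
  funext k
  unfold sqFcastKickProfile kickAvg
  rw [dif_pos (Nat.succ_pos n)]
  rfl

/-- `V̄_{n+1,t}` is the kick average of `V_t`. [formal bookkeeping] -/
theorem varKickProfile_succ (ω₂ lam β γ T : ℝ) (n : ℕ) (t : ℝ) :
    varKickProfile ω₂ lam β γ T (n + 1) t = kickAvg ω₂ lam β γ T n
      (fun z => (∫ y, y.2 0 ^ 2 ∂((pinnedChain ω₂ lam β γ).transitionKernel (n + 1) T T t.toNNReal z)) -
        (∫ y, y.2 0 ∂((pinnedChain ω₂ lam β γ).transitionKernel (n + 1) T T t.toNNReal z)) ^ 2) := by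
  funext k
  unfold varKickProfile kickAvg
  rw [dif_pos (Nat.succ_pos n)]
  rfl

section Representation

variable (hω : 0 < ω₂) (hl : 0 < lam) (hβ : 0 < β) (hγ : 0 < γ) (hT : 0 < T)
include hω hl hβ hγ hT

/-- ★★ **THE KERNEL AS A 1-D THERMAL INTEGRAL**: `K_N(t) = ∫ (k² − T)·Ḡ_{N,t}(k) dν_T(k)` (`N = n+1 ≥ 1`, every real `t`) and `θ_T·Ḡ_{N,t} ∈ L¹(ν_T)`.
[this cell] -/
theorem bathKinCorr_eq_integral_kinKickProfile (n : ℕ) (t : ℝ) :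
    Integrable (fun k : ℝ => (k ^ 2 - T) * kinKickProfile ω₂ lam β γ T (n + 1) t k) (gaussianReal 0 T.toNNReal) ∧
      bathKinCorr ω₂ lam β γ T (n + 1) t =
        ∫ k, (k ^ 2 - T) * kinKickProfile ω₂ lam β γ T (n + 1) t k ∂(gaussianReal 0 T.toNNReal) := by
  rw [kinKickProfile_succ, bathKinCorr_eq_integral_kinObs_mul_kinFcastG hω hl hβ hγ hT n t]
  have h := integral_kinObs_mul_eq_kickAvg hω hl.le hβ.le hT (measurable_kinFcastG ω₂ lam β γ T n t.toNNReal)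
    (integrable_kinObs_mul_kinFcastG hω hl hβ hγ hT n t.toNNReal)
  exact ⟨h.1, h.2.symm⟩

/-- ★ **THE COMMON-PAST CHANNEL AS A 1-D THERMAL INTEGRAL**: `CP_N(t) = ∫ (k² − T)·M̄_{N,t}(k) dν_T(k)`, `θ_T·M̄_{N,t} ∈ L¹(ν_T)`. [this cell] -/
theorem bathCommonPast_eq_integral_sqFcastKickProfile (n : ℕ) (t : ℝ) :
    Integrable (fun k : ℝ => (k ^ 2 - T) * sqFcastKickProfile ω₂ lam β γ T (n + 1) t k) (gaussianReal 0 T.toNNReal) ∧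
      bathCommonPast ω₂ lam β γ T (n + 1) t =
        ∫ k, (k ^ 2 - T) * sqFcastKickProfile ω₂ lam β γ T (n + 1) t k ∂(gaussianReal 0 T.toNNReal) := by
  rw [sqFcastKickProfile_succ]
  have h := integral_kinObs_mul_eq_kickAvg hω hl.le hβ.le hT ((measurable_momFcast ω₂ lam β γ T n t.toNNReal).pow_const 2)
    (integrable_kinObs_mul_sq_momFcast hω hl hβ hγ hT n t.toNNReal)
  refine ⟨h.1, ?_⟩
  rw [h.2]
  unfold bathCommonPast
  rw [dif_pos (Nat.succ_pos n)]
  rfl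

/-- ★★ **THE VARIANCE CHANNEL AS A 1-D THERMAL INTEGRAL**: `VC_N(t) = ∫ (k² − T)·V̄_{N,t}(k) dν_T(k)`, `θ_T·V̄_{N,t} ∈ L¹(ν_T)` — the critic's 1a
«LocalEquilibriumChannel» in Stein form: the boundary heat ↔ later boundary TEMPERATURE correlation is the thermal weight integrated against the
temperature response curve. [this cell] -/
theorem bathVarChannel_eq_integral_varKickProfile (n : ℕ) (t : ℝ) :
    Integrable (fun k : ℝ => (k ^ 2 - T) * varKickProfile ω₂ lam β γ T (n + 1) t k) (gaussianReal 0 T.toNNReal) ∧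
      bathVarChannel ω₂ lam β γ T (n + 1) t =
        ∫ k, (k ^ 2 - T) * varKickProfile ω₂ lam β γ T (n + 1) t k ∂(gaussianReal 0 T.toNNReal) := by
  rw [varKickProfile_succ]
  have hI : Integrable (fun z : PhaseSpace (n + 1) => (z.2 0 ^ 2 - T) *
      ((∫ y, y.2 0 ^ 2 ∂((pinnedChain ω₂ lam β γ).transitionKernel (n + 1) T T t.toNNReal z)) -
        (∫ y, y.2 0 ∂((pinnedChain ω₂ lam β γ).transitionKernel (n + 1) T T t.toNNReal z)) ^ 2))
      ((pinnedChain ω₂ lam β γ).gibbsMeasure (n + 1) T) :=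
    ((integrable_kinObs_mul_kinFcastG hω hl hβ hγ hT n t.toNNReal).sub
      (integrable_kinObs_mul_sq_momFcast hω hl hβ hγ hT n t.toNNReal)).congr
      (ae_of_all _ fun z => by simp only [Pi.sub_apply]; ring)
  have h := integral_kinObs_mul_eq_kickAvg hω hl.le hβ.le hT
    (F := fun z : PhaseSpace (n + 1) =>
      (∫ y, y.2 0 ^ 2 ∂((pinnedChain ω₂ lam β γ).transitionKernel (n + 1) T T t.toNNReal z)) -
        (∫ y, y.2 0 ∂((pinnedChain ω₂ lam β γ).transitionKernel (n + 1) T T t.toNNReal z)) ^ 2)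
    ((measurable_kinFcastG ω₂ lam β γ T n t.toNNReal).sub ((measurable_momFcast ω₂ lam β γ T n t.toNNReal).pow_const 2)) hI
  refine ⟨h.1, ?_⟩
  rw [h.2]
  unfold bathVarChannel
  rw [dif_pos (Nat.succ_pos n)]
  rfl

/-- The energy response curve has thermal MEAN: `∫ Ḡ_{N,t} dν_T = T` (`Ḡ ∈ L¹(ν_T)`; stationarity of `μ_T`). [this cell] -/
theorem integral_kinKickProfile (n : ℕ) (t : ℝ) :
    Integrable (kinKickProfile ω₂ lam β γ T (n + 1) t) (gaussianReal 0 T.toNNReal) ∧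
      ∫ k, kinKickProfile ω₂ lam β γ T (n + 1) t k ∂(gaussianReal 0 T.toNNReal) = T := by
  rw [kinKickProfile_succ]
  obtain ⟨hG, hGT⟩ := integrable_kinFcastG_and_integral hω hl hβ hγ hT n t.toNNReal
  have h := integral_kickAvg hω hl.le hβ.le hT (measurable_kinFcastG ω₂ lam β γ T n t.toNNReal) hG
  exact ⟨h.1, h.2.trans hGT⟩

/-- The coherent response curve: `M̄ ∈ L¹(ν_T)`, `∫ M̄_{N,t} dν_T = ‖m_t‖²_{L²(μ_T)} ≤ T`. [this cell] -/
theorem integral_sqFcastKickProfile_le (n : ℕ) (t : ℝ) :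
    Integrable (sqFcastKickProfile ω₂ lam β γ T (n + 1) t) (gaussianReal 0 T.toNNReal) ∧
      ∫ k, sqFcastKickProfile ω₂ lam β γ T (n + 1) t k ∂(gaussianReal 0 T.toNNReal) ≤ T := by
  rw [sqFcastKickProfile_succ]
  obtain ⟨hm, hmT⟩ := integrable_sq_momFcast_and_le hω hl hβ hγ hT n t.toNNReal
  have h := integral_kickAvg hω hl.le hβ.le hT ((measurable_momFcast ω₂ lam β γ T n t.toNNReal).pow_const 2) hm
  exact ⟨h.1, h.2.trans_le hmT⟩

/-- The temperature response curve is NONNEGATIVE pointwise (`V_t ≥ 0`, kernel Jensen) and `M̄ ≥ 0`. [this cell] -/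
theorem varKickProfile_nonneg (n : ℕ) (t k : ℝ) :
    0 ≤ varKickProfile ω₂ lam β γ T (n + 1) t k ∧ 0 ≤ sqFcastKickProfile ω₂ lam β γ T (n + 1) t k := by
  rw [varKickProfile_succ, sqFcastKickProfile_succ]
  unfold kickAvg
  refine ⟨integral_nonneg fun z => ?_, integral_nonneg fun z => sq_nonneg _⟩
  have h := momFcast_sq_le_kinFcast hω hl hβ hγ hT n t.toNNReal ((z.1, Function.update z.2 0 k) : PhaseSpace (n + 1))
  exact sub_nonneg.2 h

end Representation

section Evenness

variable (hω : 0 < ω₂) (hl : 0 ≤ lam) (hβ : 0 ≤ β) (hγ : 0 ≤ γ)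
include hω hl hβ hγ

/-- `G_t` is flip-even: `P_t p₀² (−x) = P_t p₀² (x)` (`K_t(−x,·) = Π_* K_t(x,·)`, `transitionKernel_neg`). [folklore] -/
theorem kinFcastG_neg (T : ℝ) (n : ℕ) (t : ℝ≥0) (x : PhaseSpace (n + 1)) :
    (∫ y, y.2 0 ^ 2 ∂((pinnedChain ω₂ lam β γ).transitionKernel (n + 1) T T t (-x))) =
      ∫ y, y.2 0 ^ 2 ∂((pinnedChain ω₂ lam β γ).transitionKernel (n + 1) T T t x) := by
  rw [PhononMeanFreePath.transitionKernel_neg ω₂ lam β γ hω hl hβ hγ (n + 1) T T t x,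
    integral_map measurable_neg.aemeasurable
      ((by fun_prop : Measurable fun y : PhaseSpace (n + 1) => y.2 0 ^ 2).aestronglyMeasurable)]
  simp only [Prod.snd_neg, Pi.neg_apply, neg_sq]

/-- `m_t` is flip-odd: `P_t p₀ (−x) = −P_t p₀ (x)`. [folklore] -/
theorem momFcast_neg (T : ℝ) (n : ℕ) (t : ℝ≥0) (x : PhaseSpace (n + 1)) :
    (∫ y, y.2 0 ∂((pinnedChain ω₂ lam β γ).transitionKernel (n + 1) T T t (-x))) =
      -∫ y, y.2 0 ∂((pinnedChain ω₂ lam β γ).transitionKernel (n + 1) T T t x) := by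
  rw [PhononMeanFreePath.transitionKernel_neg ω₂ lam β γ hω hl hβ hγ (n + 1) T T t x,
    integral_map measurable_neg.aemeasurable
      ((by fun_prop : Measurable fun y : PhaseSpace (n + 1) => y.2 0).aestronglyMeasurable)]
  simp only [Prod.snd_neg, Pi.neg_apply, integral_neg]

/-- ★ **THE RESPONSE CURVES ARE EVEN** — functions of the injected ENERGY `k²/2` only (every `N`, `t`, `T`; `lam, β, γ ≥ 0`). [this cell] -/
theorem kickProfiles_neg (T : ℝ) (N : ℕ) (t k : ℝ) :
    kinKickProfile ω₂ lam β γ T N t (-k) = kinKickProfile ω₂ lam β γ T N t k ∧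
      sqFcastKickProfile ω₂ lam β γ T N t (-k) = sqFcastKickProfile ω₂ lam β γ T N t k ∧
      varKickProfile ω₂ lam β γ T N t (-k) = varKickProfile ω₂ lam β γ T N t k := by
  rcases Nat.eq_zero_or_pos N with h0 | hN
  · subst h0; simp [kinKickProfile, sqFcastKickProfile, varKickProfile]
  obtain ⟨n, rfl⟩ : ∃ n, N = n + 1 := ⟨N - 1, by omega⟩
  rw [kinKickProfile_succ, sqFcastKickProfile_succ, varKickProfile_succ]
  refine ⟨kickAvg_neg (fun z => kinFcastG_neg hω hl hβ hγ T n t.toNNReal z) k,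
    kickAvg_neg (fun z => by simp only [momFcast_neg hω hl hβ hγ T n t.toNNReal z, neg_sq]) k,
    kickAvg_neg (fun z => by simp only [kinFcastG_neg hω hl hβ hγ T n t.toNNReal z,
      momFcast_neg hω hl hβ hγ T n t.toNNReal z, neg_sq]) k⟩

end Evenness

end Profiles

end Summit.AtomisticToContinuum.FouriersLaw.Theorems.BoundedResponse.HeatSpreading

end
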